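import Literature.AnabelianGeometry.SemiGraphs.TemperedCompactFixedSystemsBaire
import Literature.AnabelianGeometry.SemiGraphs.TemperedCompactInVerticialAt
import HarnessLib

/-!
# Escaping compact subgroups falsify [SemiAnbd] Thm 3.7 (iii) at a graph — the NEGATIVE-MODULO form

Mochizuki, *Semi-graphs of anabelioids*, Publ. RIMS **42** (2006), §3, Theorem 3.7 (iii), author's
manuscript pp. 40–41 [cite: MochizukiSemiAnbd2006, Thm 3.7(iii) pp.40-41] ("Every compact subgroup of
`π₁^temp(𝒢)` is contained in at least one verticial subgroup").  The printed proof (p. 41 "since the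
semi-graphs `𝔾_j` are all finite", Comments (2020) (6)) is a proof for FINITE underlying semi-graphs; the
cell proves exactly that (`compactInVerticialAt_of_finiteGraph`, abc-iut-L3-t8) and reduces the countable
infinite case to the existence of compatible fixed systems ((FIX∞), abc-iut-L3-t10 / -t6 / w4-d080 /
w5-d160).  abc-iut-L3-d1's desk countermodel candidate `𝒢_θ` (twisted gluings along a ray, staging memo
COUNTERMODEL-Thm37iii-infinite.md, second-read by abc-iut-L3-t6) exhibits a compact `C ≅ ℤ_p` whose fixed
sets ESCAPE along the ray's end.

This PROOF-ONLY file (abc-iut-L3-t6; no definitions, no named fact) isolates the FORMAL half of such a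
refutation over the level data `D : VerticialLevelData 𝒢 c` of a chart: by the identification (I1)
(`VerticialLevelData.fix`: every verticial subgroup fixes a compatible vertex system), a subgroup `C`
that fixes NO compatible vertex system of the trees lies in NO verticial subgroup
(`not_exists_verticial_of_escaping`); hence a compact such `C` falsifies the first clause of
`CompactInVerticialAt 𝒢` at the chart `c` (`not_compactInVerticialAt_of_escaping`), and with it the
∀-countable named fact `CompactInVerticial` (`not_compactInVerticial_of_escaping`).  Dually, by the cell's
reductions, "escaping" is equivalent to "some element of `C` has unbounded displacement"
(`escaping_of_not_exists_fixedSystem`, contrapositive of `exists_fixedSystem_of_pointwise_bdd`), so the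
whole refutation is reduced to ONE construction item: a Thm-3.7 graph, a chart with level data, and a
compact subgroup with an element of unbounded displacement.  NOTHING is asserted about any particular
graph here (no escaping compact subgroup is constructed in this file); for finite graphs none exists
(`compactInVerticialAt_of_finiteGraph`).  Nothing here bears on [IUTchIII] Cor. 3.12 or on the IUT
papers, which use finite dual semi-graphs only.
-/

namespace Literature.AnabelianGeometry.SemiGraphs

open CategoryTheory Topology

universe v u

namespace ProfiniteSemiGraph

namespace VerticialLevelData

variable {𝒢 : ProfiniteSemiGraph.{u}} {c : TemperedPiChart 𝒢} (D : VerticialLevelData.{v} 𝒢 c)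

/-- **(I1) contrapositive**: a subgroup fixing NO compatible vertex system of the level trees lies in no
verticial subgroup (every verticial subgroup fixes a compatible system, `VerticialLevelData.fix`).
[cite: MochizukiSemiAnbd2006, Thm 3.7(iii) p.41] -/
theorem not_exists_verticial_of_escaping (C : Subgroup c.G)
    (hesc : ∀ x : ∀ j, (D.tree j).Vertex, (∀ ⦃i j : D.J⦄ (h : i ≤ j), (D.trans h).vertexMap (x j) = x i) →
      ∃ g ∈ C, ∃ j, (D.act j g).hom.vertexMap (x j) ≠ x j) :
    ¬ ∃ (v : 𝒢.graph.Vertex) (H : Subgroup c.G), H ∈ verticialSubgroups c v ∧ C ≤ H := by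
  rintro ⟨v, H, hH, hCH⟩
  obtain ⟨x, hxc, hxf⟩ := D.fix v H hH
  obtain ⟨g, hg, j, hne⟩ := hesc x hxc
  exact hne (hxf g (hCH hg) j)

/-- **An escaping COMPACT subgroup falsifies `CompactInVerticialAt 𝒢`** (the body of [SemiAnbd] Thm 3.7
(iii) at `𝒢`, first clause, at the chart `c`): if `𝒢` satisfies the hypotheses of Thm 3.7 and some compact
`C ≤ π₁^temp(𝒢)` fixes no compatible vertex system of the level data `D` of a chart, then
`CompactInVerticialAt 𝒢` is false.  NEGATIVE-MODULO form: no such `(𝒢, c, D, C)` is constructed here.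
[cite: MochizukiSemiAnbd2006, Thm 3.7(iii) pp.40-41] -/
theorem not_compactInVerticialAt_of_escaping (h37 : 𝒢.Thm37Hypotheses) (C : Subgroup c.G)
    (hC : IsCompact (C : Set c.G))
    (hesc : ∀ x : ∀ j, (D.tree j).Vertex, (∀ ⦃i j : D.J⦄ (h : i ≤ j), (D.trans h).vertexMap (x j) = x i) →
      ∃ g ∈ C, ∃ j, (D.act j g).hom.vertexMap (x j) ≠ x j) :
    ¬ CompactInVerticialAt 𝒢 := fun hCV =>
  D.not_exists_verticial_of_escaping C hesc (hCV h37 c C hC).1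

/-- … and hence falsifies the ∀-countable named fact `CompactInVerticial` ([SemiAnbd] Thm 3.7 (iii) as
typed for ALL countable semi-graphs; finite graphs are settled positively by
`compactInVerticialAt_of_finiteGraph`). NEGATIVE-MODULO form. [cite: MochizukiSemiAnbd2006, Thm 3.7(iii) pp.40-41] -/
theorem not_compactInVerticial_of_escaping (h37 : 𝒢.Thm37Hypotheses) (C : Subgroup c.G)
    (hC : IsCompact (C : Set c.G))
    (hesc : ∀ x : ∀ j, (D.tree j).Vertex, (∀ ⦃i j : D.J⦄ (h : i ≤ j), (D.trans h).vertexMap (x j) = x i) →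
      ∃ g ∈ C, ∃ j, (D.act j g).hom.vertexMap (x j) ≠ x j) :
    ¬ CompactInVerticial.{u} := fun hCV =>
  D.not_compactInVerticialAt_of_escaping h37 C hC hesc (compactInVerticial_iff_forall_at.mp hCV 𝒢)

/-- **Escape ⇔ unbounded displacement** (contrapositive of the cell's reduction
`exists_fixedSystem_of_pointwise_bdd`, abc-iut-L3-t6): for a COMPACT `C`, if `C` fixes no compatible
vertex system then, for every compatible reference system `x`, SOME element of `C` has unbounded
displacement along the tower — the form in which abc-iut-L3-d1's candidate `𝒢_θ` exhibits the escape
(`dist_{T_j}(x̃_0, c·x̃_0) → ∞`). [cite: MochizukiSemiAnbd2006, Thm 3.7(iii) p.41] -/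
theorem exists_unbounded_displacement_of_escaping (C : Subgroup c.G) (hC : IsCompact (C : Set c.G))
    (hesc : ∀ x : ∀ j, (D.tree j).Vertex, (∀ ⦃i j : D.J⦄ (h : i ≤ j), (D.trans h).vertexMap (x j) = x i) →
      ∃ g ∈ C, ∃ j, (D.act j g).hom.vertexMap (x j) ≠ x j)
    (x : ∀ j, (D.tree j).Vertex) (hx : ∀ ⦃i j : D.J⦄ (h : i ≤ j), (D.trans h).vertexMap (x j) = x i) :
    ∃ g ∈ C, ∀ N : ℕ, ∃ j, N < (D.tree j).subdivision.dist (Sum.inl (x j))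
      (Sum.inl ((D.act j g).hom.vertexMap (x j))) := by
  by_contra hcon
  have hpt : ∀ g ∈ C, ∃ N : ℕ, ∀ j, (D.tree j).subdivision.dist (Sum.inl (x j))
      (Sum.inl ((D.act j g).hom.vertexMap (x j))) ≤ N := by
    intro g hg
    by_contra hg'
    apply hcon
    refine ⟨g, hg, fun N => ?_⟩
    by_contra hN
    apply hg'
    refine ⟨N, fun j => ?_⟩
    by_contra hj
    exact hN ⟨j, not_le.mp hj⟩
  obtain ⟨y, hyc, hyf⟩ := D.exists_fixedSystem_of_pointwise_bdd C hC x hx hpt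
  obtain ⟨g, hg, j, hne⟩ := hesc y hyc
  exact hne (hyf g hg j)

/-- Conversely (trivially), a subgroup with an element of unbounded displacement relative to EVERY
compatible system fixes no compatible system (a fixed system has displacement `0`). Together with
`exists_unbounded_displacement_of_escaping`: for compact `C`, «escaping» ⟺ «relative to every compatible
`x`, some element of `C` has unbounded displacement». [cite: MochizukiSemiAnbd2006, Thm 3.7(iii) p.41] -/
theorem escaping_of_unbounded_displacement (C : Subgroup c.G)
    (hunb : ∀ x : ∀ j, (D.tree j).Vertex, (∀ ⦃i j : D.J⦄ (h : i ≤ j), (D.trans h).vertexMap (x j) = x i) →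
      ∃ g ∈ C, ∀ N : ℕ, ∃ j, N < (D.tree j).subdivision.dist (Sum.inl (x j))
        (Sum.inl ((D.act j g).hom.vertexMap (x j))))
    (x : ∀ j, (D.tree j).Vertex) (hx : ∀ ⦃i j : D.J⦄ (h : i ≤ j), (D.trans h).vertexMap (x j) = x i) :
    ∃ g ∈ C, ∃ j, (D.act j g).hom.vertexMap (x j) ≠ x j := by
  obtain ⟨g, hg, hN⟩ := hunb x hx
  obtain ⟨j, hj⟩ := hN 0
  refine ⟨g, hg, j, fun heq => ?_⟩
  rw [heq, SimpleGraph.dist_self] at hj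
  exact Nat.lt_irrefl 0 hj

end VerticialLevelData

end ProfiniteSemiGraph

end Literature.AnabelianGeometry.SemiGraphs
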